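import Summits.HodgeConjecture.FermatCycles.ConditionQFourfoldSearch
import Summits.HodgeConjecture.FermatCycles.ConditionQFourfoldSixtyTable
import HarnessLib

/-!
# Shioda's stable-generation condition `(Q⁴ₘ)` at `m = 60` — kernel certificate (part A of 2)

HONEST FRAMING: explicit algebraic cycles for specific Hodge classes on Fermat/Delsarte varieties;
residual open instances listed; no claim on general Hodge.

Topic path `Summits/HodgeConjecture/FermatCycles/` of cell `pub-hfermat` (new work, not literature: a computer determination of the cell —
`pub-hfermat-enum/P4-TABLE.md` §(Q⁴ₘ), two implementations — certified by the Lean kernel). Framework: `ConditionQFourfold.lean`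
(certificate Booleans, searches `checkQU`/`checkQN`) and `ConditionQFourfoldSearch.lean` (`conditionQ_four_of_normalized`).

THE STATEMENT. Shioda, Math. Ann. 245 (1979) §4 p. 183: `(Qⁿₘ)` — every element of `Mₘ(y)`, `3 ≤ y ≤ n/2 + 1`, is `ξ₁ − ξ₂` with
`ξ₁, ξ₂ ∈ M'ₘ = ⟨Mₘ(1), Mₘ(2), Mₘ(3)^sd⟩` (pairs, Hodge classes of the Fermat surface, semi-decomposable sextuples); by his Claim
(p. 183, Lemmas 2–3) `(Qⁿₘ)` may replace `(Pⁿₘ)` in Theorem III (`⇒` the Hodge conjecture for `Xⁿₘ`); p. 184: "we do not know any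
value of `m` which satisfies `(Qₘ)` but not `(Pₘ)`". Tree: `Literature.AlgebraicGeometry.Shioda1979.ConditionQ m n`, `MPrime`,
`forall_of_conditionQ` (the Claim's arithmetic spine), `ConditionP` (Math. Ann. form of `(P)`), `FermatCharacter.ShiodaConditionUpTo`
(Proc. Japan Acad. form, with the semi-decomposable alternative).

WHAT IS PROVED HERE (level `m = 60`, part A).
* part A of 2: the kernel searches `checkQU 60 T 1 59`, `checkQN 60 T 1 4` (119404 tuples);

NUMBERS (this seat's search `code/lit/q4/q4norm.py` = implementation 2; implementation 1 = ENUM `code/enum/q4table.py`,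
`data/shioda_Q4_m3-100.json`): case U visits 54246 sorted tuples and case N 147593; 12579 of them are Hodge sextuples; all but 43 carry a
`(P)`-witness (case N pair 7216, case N quasi 2688, case N semi 384, case U pair 1577, case U quasi 621, case U semi 50); the other 43 — `(1, 3, 32, 44, 49, 51)` (case U); `(1, 8, 9, 49, 56, 57)` (case U); `(1, 8, 27, 39, 49, 56)` (case U); `(1, 13, 16, 41, 53, 56)` (case U); `(1, 16, 25, 31, 52, 55)` (case U); `(1, 17, 27, 31, 47, 57)` (case U); `(1, 17, 32, 37, 41, 52)` (case U); `(1, 21, 23, 31, 51, 53)` (case U); `(1, 21, 32, 33, 44, 49)` (case U); `(3, 4, 15, 51, 52, 55)` (case N); `(3, 4, 25, 45, 51, 52)` (case N); `(3, 5, 32, 39, 45, 56)` (case N); `(3, 5, 32, 44, 45, 51)` (case N); `(3, 15, 16, 39, 52, 55)` (case N); `(3, 15, 32, 35, 39, 56)` (case N); `(3, 15, 32, 35, 44, 51)` (case N); `(3, 16, 25, 39, 45, 52)` (case N); `(4, 15, 21, 28, 55, 57)` (case N); `(4, 15, 21, 33, 52, 55)` (case N); `(4, 15, 27, 28, 51,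 55)` (case N); `(4, 16, 25, 28, 52, 55)` (case N); `(4, 21, 25, 28, 45, 57)` (case N); `(4, 21, 25, 33, 45, 52)` (case N); `(4, 25, 27, 28, 45, 51)` (case N); `(5, 8, 9, 45, 56, 57)` (case N); `(5, 8, 21, 44, 45, 57)` (case N); `(5, 8, 27, 39, 45, 56)` (case N); `(5, 8, 27, 44, 45, 51)` (case N); `(5, 8, 32, 35, 44, 56)` (case N); `(5, 9, 32, 33, 45, 56)` (case N); `(5, 21, 32, 33, 44, 45)` (case N); `(8, 9, 15, 35, 56, 57)` (case N); `(8, 15, 21, 35, 44, 57)` (case N); `(8, 15, 27, 35, 39, 56)` (case N); `(8, 15, 27, 35, 44, 51)` (case N); `(9, 15, 16, 28, 55, 57)` (case N); `(9, 15, 16, 33, 52, 55)` (case N); `(9, 15, 32, 33, 35, 56)` (case N); `(9, 16, 25, 28, 45, 57)` (case N); `(9, 16, 25, 33, 45, 52)` (case N); `(15, 16, 27, 28, 39, 55)` (case N); `(15, 21, 32, 33, 35, 44)` (case N); `(16, 25, 27, 28, 39, 45)` (case N) — carry the table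
certificate(s) written out in the statements below (generators checked by `genB`, the identity `s + ΣX = ΣY` by `decide`, all inside the kernel search).

PRINT STATUS (lit seat, 2026-08-20). `60 = 2²·3·5`: HC for every `Xⁿ₆₀` IS in print (Aoki 2000 Thm 0.1 (i), p. 185, `d = 0`). The point of this level is Shioda's QUESTION (p. 184): `(Q⁴₆₀)` holds while `(P⁴₆₀)` fails (cell table, two implementations; kernel here).

References: [Shioda1979HodgeFermat] T. Shioda, Math. Ann. 245 (1979) 175–184, §3 p. 180 (`(Pⁿₘ)`), §4 pp. 183–184 (`M'ₘ`, `(Qⁿₘ)`, Claim,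
the question); [Shioda1979PJA] T. Shioda, Proc. Japan Acad. 55A (1979) §1 (Definition (i)–(iii), `(Pⁿₘ)'`); [daSilva2021HodgeFermat]
G. da Silva Jr., Experimental Results 2 (2021) e22, Def. 2.4, Question 1; [Aoki2000FermatTypeRemarks] N. Aoki, Comment. Math. Univ.
St. Pauli 49 (2000), Thm 0.1. Cell: `pub-hfermat-enum/P4-TABLE.md`, `data/shioda_Q4_m3-100.json`, `code/lit/q4/` (this seat).
-/

namespace Summit.HodgeConjecture.FermatCycles.ConditionQFourfold

open Multiset
open Literature.AlgebraicGeometry.HodgeTheory Literature.AlgebraicGeometry.HodgeTheory.FermatCharacter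
open Literature.AlgebraicGeometry.Shioda1982 Literature.AlgebraicGeometry.Shioda1979
open Summit.HodgeConjecture.FermatCycles.ShiodaConditionFourfold

/-! ### Level `60` — part A -/

/-! The certificate table at level `60` is the definition `table60` of `ConditionQFourfoldSixtyTable.lean` (43 entries `(key, X, Y)`,
`s + ΣX = ΣY`; found by `code/lit/q4/q4norm.py`, every entry checked by the kernel inside the searches). -/

set_option maxHeartbeats 0 in
/-- The `(Q)`-search at level `60`, case U, first free representative in `[1, 60)` (54246 tuples). Kernel.
[cite: Shioda1979HodgeFermat, §4 condition (Qⁿₘ), p. 183] -/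
theorem checkQU_60_1 :
    checkQU 60
      table60
      1 59 = true := by
  decide +kernel

set_option maxHeartbeats 0 in
/-- The `(Q)`-search at level `60`, case N, first free representative in `[1, 5)` (65158 tuples). Kernel.
[cite: Shioda1979HodgeFermat, §4 condition (Qⁿₘ), p. 183] -/
theorem checkQN_60_1 :
    checkQN 60
      table60
      1 4 = true := by
  decide +kernel

end Summit.HodgeConjecture.FermatCycles.ConditionQFourfold
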